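import Mathlib
import HarnessLib
import Summits.PneNP.PneNP.Theorems.CnfIdealGenLengthRankDefectRepresentationsBlockLaw
import Summits.PneNP.PneNP.Theorems.CnfIdealGenLengthRankDefectRepresentationsExactification

/-!
# Crux `RankDefectRepresentations` (stmt-PneNP-18923), line `phantom-kernel`: stub R0 `stub_linearPhantoms`

CALIBRATION RUNG R0 of the line (lead prover, 2026-08-27): the inner predicate of the hard stub S1 — an
almost-representation `M` of the `n`-cube in characteristic `0` with axiom defects of rank `≤ t`, a subspace `U`,
and a CONTRADICTORY width-`w` phantom theory (every assignment falsifies some clause of length `≤ w` whose clause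
word kills `U`) — holds for EVERY `n` at LINEAR ratio: `t ≤ 5`, `n ≤ 5 (dim U + 1)`, `w = 3` (S1 asks for
`dim U > n^c · t` for every `c`).  Construction over `ℚ` (found by the lead's gadget search, verified in exact
arithmetic): `N = ⌊n/5⌋` blocks `ℚ²`; variable `5b + r` acts, for `r = 0`, as the projection `y_b` onto block `b`;
for `r = 1`, as the projection `z_b` onto the blocks `≤ b`; for `r = 2, 3, 4`, on block `b` only, as the idempotents
`G₀ = diag(0,1)`, `G₁ = [[0,1],[0,1]]`, `G₂ = [[1,0],[1,0]]`; variables `≥ 5N` act by `0`.  `U` is spanned by the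
first coordinate vectors of the blocks (`dim U = N`).  Validated clauses: `[z_{N-1}]`, `[¬z_b, z_{b-1}, y_b]`,
`[¬z_0, y_0]`, `[¬y_b, ¬x0_b]`, `[¬y_b, ¬x1_b]`, `[¬y_b, x0_b, x2_b]`, `[¬y_b, x1_b, ¬x2_b]` (the last two clause
words vanish identically: `(1-G₀)(1-G₂) = 0 = (1-G₁)G₂`; `G₀ e₁ = G₁ e₁ = 0`); every assignment falsifies one of
them.  Commutators live on one block, so `t = 2`.  No definitions are introduced.
HONEST FRAMING: elementary; P ≠ NP is not moved; F-N2 is a FRONTIER formal rung.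
-/

set_option linter.dupNamespace false -- `Summit.PneNP.PneNP.…`: summit = sub-problem name (D-0017)

namespace Summit.PneNP.PneNP.Theorems.CnfIdealGenLengthRankDefectRepresentationsLinearPhantoms

open Filter
open Literature.Computability.Complexity
open Literature.Computability.MetaComplexity
open Literature.Computability.MetaComplexity.NCIPS
open Summit.PneNP.PneNP.Theorems.CnfIdealGenLength

/-! ### The 2×2 gadget `G₀ = diag(0,1)`, `G₁ = [[0,1],[0,1]]`, `G₂ = [[1,0],[1,0]]` -/

/-- `G₀² = G₀`. [folklore] -/
theorem g0_idem : (!![0, 0; 0, 1] : Matrix (Fin 2) (Fin 2) ℚ) * !![0, 0; 0, 1] = !![0, 0; 0, 1] := by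
  ext i j; fin_cases i <;> fin_cases j <;> simp
/-- `G₁² = G₁`. [folklore] -/
theorem g1_idem : (!![0, 1; 0, 1] : Matrix (Fin 2) (Fin 2) ℚ) * !![0, 1; 0, 1] = !![0, 1; 0, 1] := by
  ext i j; fin_cases i <;> fin_cases j <;> simp
/-- `G₂² = G₂`. [folklore] -/
theorem g2_idem : (!![1, 0; 1, 0] : Matrix (Fin 2) (Fin 2) ℚ) * !![1, 0; 1, 0] = !![1, 0; 1, 0] := by
  ext i j; fin_cases i <;> fin_cases j <;> simp
/-- `(1 - G₀)(1 - G₂) = 0`. [folklore] -/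
theorem one_sub_g0_mul_one_sub_g2 :
    (1 - !![0, 0; 0, 1] : Matrix (Fin 2) (Fin 2) ℚ) * (1 - !![1, 0; 1, 0]) = 0 := by
  ext i j; fin_cases i <;> fin_cases j <;> simp [Matrix.one_fin_two]
/-- `(1 - G₁) G₂ = 0`. [folklore] -/
theorem one_sub_g1_mul_g2 : (1 - !![0, 1; 0, 1] : Matrix (Fin 2) (Fin 2) ℚ) * !![1, 0; 1, 0] = 0 := by
  ext i j; fin_cases i <;> fin_cases j <;> simp [Matrix.one_fin_two]

/-! ### The witness -/

/-- STUB R0 `stub_linearPhantoms` of the line `phantom-kernel` (registered signature, verbatim): contradictory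
width-`3` phantoms with `t ≤ 5` and `n ≤ 5 (dim U + 1)` for every `n`. [folklore] -/
theorem stub_linearPhantoms :
    ∃ w C : ℕ, ∀ n : ℕ, ∃ (K : Type) (_ : Field K) (_ : CharZero K) (d t : ℕ)
      (M : Fin n → Matrix (Fin d) (Fin d) K) (U : Submodule K (Fin d → K)),
      (∀ g : MonoidAlgebra K (FreeMonoid (Fin n)), IsAxiom g →
        (MonoidAlgebra.lift K (Matrix (Fin d) (Fin d) K) (FreeMonoid (Fin n)) (FreeMonoid.lift M) g).rank
          ≤ t) ∧
      t ≤ C ∧ n ≤ C * (Module.finrank K U + 1) ∧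
      ∀ σ : Fin n → Bool, ∃ κ : Clause (Fin n), κ.length ≤ w ∧
        (∀ u ∈ U, (MonoidAlgebra.lift K (Matrix (Fin d) (Fin d) K) (FreeMonoid (Fin n))
          (FreeMonoid.lift M) (clauseWord K κ)).mulVec u = 0) ∧
        Clause.eval σ κ = false := by
  refine ⟨3, 5, fun n => ?_⟩
  classical
  -- number of blocks
  set N : ℕ := n / 5 with hN
  have hnN : n < 5 * (N + 1) := by omega
  have h5N : 5 * N ≤ n := by omega
  -- the gadget
  let G0 : Matrix (Fin 2) (Fin 2) ℚ := !![0, 0; 0, 1]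
  let G1 : Matrix (Fin 2) (Fin 2) ℚ := !![0, 1; 0, 1]
  let G2 : Matrix (Fin 2) (Fin 2) ℚ := !![1, 0; 1, 0]
  -- block of the variable with role `r` and home block `b`, at block `b'`
  let blk : ℕ → Fin N → Fin N → Matrix (Fin 2) (Fin 2) ℚ := fun r b b' =>
    if r = 0 then (if b' = b then 1 else 0)
    else if r = 1 then (if b' ≤ b then 1 else 0)
    else if r = 2 then (if b' = b then G0 else 0)
    else if r = 3 then (if b' = b then G1 else 0)
    else (if b' = b then G2 else 0)
  let B : Fin n → Fin N → Matrix (Fin 2) (Fin 2) ℚ := fun i b' =>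
    if h : i.val / 5 < N then blk (i.val % 5) ⟨i.val / 5, h⟩ b' else 0
  let d : ℕ := Fintype.card (Fin 2 × Fin N)
  let e : Fin 2 × Fin N ≃ Fin d := Fintype.equivFin _
  let M : Fin n → Matrix (Fin d) (Fin d) ℚ := fun i => Matrix.reindex e e (Matrix.blockDiagonal (B i))
  let v : Fin N → (Fin d → ℚ) := fun b => Pi.single (e (0, b)) 1
  let U : Submodule ℚ (Fin d → ℚ) := Submodule.span ℚ (Set.range v)
  -- variables: role `r < 5` of block `b` is the variable `5 b + r`
  have hvlt : ∀ (b : Fin N) (r : ℕ), r < 5 → 5 * b.val + r < n := by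
    intro b r hr; have := b.2; omega
  let var : Fin N → (r : ℕ) → r < 5 → Fin n := fun b r hr => ⟨5 * b.val + r, hvlt b r hr⟩
  have hBvar : ∀ (b : Fin N) (r : ℕ) (hr : r < 5) (b' : Fin N), B (var b r hr) b' = blk r b b' := by
    intro b r hr b'
    have h1 : (5 * b.val + r) / 5 = b.val := by omega
    have h2 : (5 * b.val + r) % 5 = r := by omega
    have h3 : (5 * b.val + r) / 5 < N := by rw [h1]; exact b.2
    simp only [B, var, h3, dif_pos, h2]
    congr 1
    exact Fin.ext h1
  -- evaluation at `M`
  have hev : ∀ g : MonoidAlgebra ℚ (FreeMonoid (Fin n)),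
      MonoidAlgebra.lift ℚ (Matrix (Fin d) (Fin d) ℚ) (FreeMonoid (Fin n)) (FreeMonoid.lift M) g =
        Matrix.reindex e e (Matrix.blockDiagonal fun b =>
          MonoidAlgebra.lift ℚ (Matrix (Fin 2) (Fin 2) ℚ) (FreeMonoid (Fin n)) (FreeMonoid.lift fun i => B i b) g) := by
    intro g
    show MonoidAlgebra.lift ℚ (Matrix (Fin d) (Fin d) ℚ) (FreeMonoid (Fin n))
      (FreeMonoid.lift fun i => Matrix.reindex e e (Matrix.blockDiagonal (B i))) g = _
    rw [lift_reindex, lift_blockDiagonal]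
  -- clause words at `M`, blockwise
  have hword : ∀ κ : Clause (Fin n),
      MonoidAlgebra.lift ℚ (Matrix (Fin d) (Fin d) ℚ) (FreeMonoid (Fin n)) (FreeMonoid.lift M) (clauseWord ℚ κ) =
        Matrix.reindex e e (Matrix.blockDiagonal fun b' =>
          (κ.map fun l => if l.2 then 1 - B l.1 b' else B l.1 b').prod) := by
    intro κ
    rw [hev]
    congr 2
    funext b'
    exact lift_clauseWord_eq (fun i => B i b') κ
  -- vectors of `U` are killed by block-diagonal matrices whose blocks have zero first column
  have hker : ∀ F : Fin N → Matrix (Fin 2) (Fin 2) ℚ, (∀ b' (x : Fin 2), F b' x 0 = 0) →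
      ∀ u ∈ U, (Matrix.reindex e e (Matrix.blockDiagonal F)).mulVec u = 0 := by
    intro F hF u hu
    have hle : U ≤ LinearMap.ker (Matrix.toLin' (Matrix.reindex e e (Matrix.blockDiagonal F))) := by
      refine Submodule.span_le.mpr ?_
      rintro _ ⟨b, rfl⟩
      simp only [SetLike.mem_coe, LinearMap.mem_ker, Matrix.toLin'_apply, v, Matrix.mulVec_single_one]
      funext x
      simp only [Matrix.col_apply, Matrix.reindex_apply, Matrix.submatrix_apply, Equiv.symm_apply_apply,
        Matrix.blockDiagonal_apply, Pi.zero_apply]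
      split_ifs with h
      · exact hF _ _
      · rfl
    have := hle hu
    rwa [LinearMap.mem_ker, Matrix.toLin'_apply] at this
  -- all blocks are idempotent
  have hblk_idem : ∀ r b b', blk r b b' * blk r b b' = blk r b b' := by
    intro r b b'
    simp only [blk]
    split_ifs <;> first | simp | exact g0_idem | exact g1_idem | exact g2_idem
  have hB_idem : ∀ i b', B i b' * B i b' = B i b' := by
    intro i b'
    simp only [B]
    split_ifs
    · exact hblk_idem _ _ _
    · simp
  -- off its home block a variable acts by `0` or `1`
  have hB_scalar : ∀ (i : Fin n) (b' : Fin N), (∀ h : i.val / 5 < N, b' ≠ ⟨i.val / 5, h⟩) →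
      B i b' = 0 ∨ B i b' = 1 := by
    intro i b' hb'
    simp only [B]
    split_ifs with h
    · have hne := hb' h
      simp only [blk]
      split_ifs <;> simp_all
    · left; rfl
  refine ⟨ℚ, inferInstance, inferInstance, d, 2, M, U, ?_, by norm_num, ?_, ?_⟩
  · -- axiom ranks ≤ 2
    intro g hg
    rcases hg with ⟨i, rfl⟩ | ⟨i, j, hij, rfl⟩
    · have h0 : (fun b => MonoidAlgebra.lift ℚ (Matrix (Fin 2) (Fin 2) ℚ) (FreeMonoid (Fin n))
          (FreeMonoid.lift fun i => B i b) (X ℚ i * X ℚ i - X ℚ i)) = fun b => 0 := by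
        funext b; simp [X, hB_idem i b]
      rw [hev, Matrix.rank_reindex, h0]
      have : (Matrix.blockDiagonal fun _ : Fin N => (0 : Matrix (Fin 2) (Fin 2) ℚ)) = 0 := Matrix.blockDiagonal_zero
      rw [this, Matrix.rank_zero]; exact Nat.zero_le _
    · have hblk : (fun b => MonoidAlgebra.lift ℚ (Matrix (Fin 2) (Fin 2) ℚ) (FreeMonoid (Fin n))
          (FreeMonoid.lift fun i => B i b) (X ℚ i * X ℚ j - X ℚ j * X ℚ i)) =
          fun b => B i b * B j b - B j b * B i b := by
        funext b; simp [X]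
      rw [hev, Matrix.rank_reindex, hblk, Literature.Barriers.ValiantsHypothesis.rank_blockDiagonal]
      -- the commutator is supported on the home block of `i`
      have hzero : ∀ b' : Fin N, (∀ h : i.val / 5 < N, b' ≠ ⟨i.val / 5, h⟩) →
          B i b' * B j b' - B j b' * B i b' = 0 := by
        intro b' hb'
        rcases hB_scalar i b' hb' with h | h <;> rw [h] <;> simp
      by_cases hi : i.val / 5 < N
      · let b₀ : Fin N := ⟨i.val / 5, hi⟩
        have hle : ∀ b' : Fin N, (B i b' * B j b' - B j b' * B i b').rank ≤ if b' = b₀ then 2 else 0 := by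
          intro b'
          by_cases hb : b' = b₀
          · subst hb
            have := Matrix.rank_le_card_width (B i b₀ * B j b₀ - B j b₀ * B i b₀)
            simp only [Fintype.card_fin] at this
            simpa using this
          · rw [hzero b' (fun h => hb), Matrix.rank_zero]; exact Nat.zero_le _
        calc ∑ b', (B i b' * B j b' - B j b' * B i b').rank ≤ ∑ b' : Fin N, (if b' = b₀ then 2 else 0) :=
              Finset.sum_le_sum fun b' _ => hle b'
          _ = 2 := by rw [Finset.sum_ite_eq']; simp
      · have : ∀ b' : Fin N, B i b' * B j b' - B j b' * B i b' = 0 := fun b' => hzero b' (fun h => absurd h hi)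
        simp [this]
  · -- `n ≤ 5 (dim U + 1)`, `dim U = N`
    have hli : LinearIndependent ℚ v := by
      have hv : v = ⇑(Pi.basisFun ℚ (Fin d)) ∘ (fun b : Fin N => e (0, b)) := by
        funext b; simp [v]
      rw [hv]
      refine (Pi.basisFun ℚ (Fin d)).linearIndependent.comp (fun b : Fin N => e (0, b)) ?_
      intro b b' hbb'
      have := e.injective hbb'
      simpa using this
    have hU : Module.finrank ℚ U = N := by
      simp only [U]
      rw [finrank_span_eq_card hli, Fintype.card_fin]
    rw [hU]; omega
  · -- the contradictory width-3 theory
    intro σ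
    by_cases hN0 : N = 0
    · -- no blocks: `U = 0`, the empty clause
      refine ⟨[], by simp, ?_, rfl⟩
      intro u hu
      have hu0 : u = 0 := by
        have : U = ⊥ := by
          simp only [U]
          rw [Submodule.span_eq_bot]
          rintro _ ⟨b, rfl⟩
          exact absurd b.2 (by omega)
        simpa [this] using hu
      rw [hu0, Matrix.mulVec_zero]
    -- `N ≥ 1`: the chain variables `z_b = var b 1`, selectors `y_b = var b 0`
    have hNpos : 0 < N := Nat.pos_of_ne_zero hN0
    by_cases hzlast : σ (var ⟨N - 1, by omega⟩ 1 (by norm_num)) = false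
    · -- (i) `z_{N-1}` false: the unit clause `[z_{N-1}]`, whose word `1 - z_{N-1}` vanishes
      refine ⟨[(var ⟨N - 1, by omega⟩ 1 (by norm_num), true)], by simp, ?_, ?_⟩
      · intro u hu
        rw [hword]
        apply hker _ _ u hu
        intro b' x
        simp only [List.map_cons, List.map_nil, List.prod_cons, List.prod_nil, mul_one, if_true, hBvar]
        have : (b' ≤ (⟨N - 1, by omega⟩ : Fin N)) := by
          show b'.val ≤ N - 1; have := b'.2; omega
        simp [blk, this]
      · simp [Clause.eval, Literal.eval, hzlast]
    · -- (ii) some `z_b` is true; take the least such `b`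
      have hex : ∃ k, ∃ h : k < N, σ (var ⟨k, h⟩ 1 (by norm_num)) = true :=
        ⟨N - 1, by omega, by simpa using hzlast⟩
      let k := Nat.find hex
      obtain ⟨hk, hzk⟩ := Nat.find_spec hex
      have hmin : ∀ k' < k, ∀ h' : k' < N, σ (var ⟨k', h'⟩ 1 (by norm_num)) = false := by
        intro k' hk' h'
        have := Nat.find_min hex hk'
        simp only [not_exists] at this
        simpa using this h'
      let b : Fin N := ⟨k, hk⟩
      by_cases hy : σ (var b 0 (by norm_num)) = false
      · -- (ii-a) `y_b` false: the chain clause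
        by_cases hk0 : k = 0
        · refine ⟨[(var b 1 (by norm_num), false), (var b 0 (by norm_num), true)], by simp, ?_, ?_⟩
          · intro u hu
            rw [hword]
            apply hker _ _ u hu
            intro b' x
            simp only [List.map_cons, List.map_nil, List.prod_cons, List.prod_nil, mul_one, if_true,
              Bool.false_eq_true, if_false, hBvar]
            by_cases hb' : b' = b
            · simp [blk, hb']
            · have : ¬ b' ≤ b := by
                intro hle; apply hb'; apply Fin.ext; show b'.val = k
                have : b'.val ≤ k := hle; omega
              simp [blk, hb', this]
          · simp [Clause.eval, Literal.eval, hy]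
            exact hzk
        · have hk1 : k - 1 < N := by omega
          let bp : Fin N := ⟨k - 1, hk1⟩
          have hzp : σ (var bp 1 (by norm_num)) = false := hmin (k - 1) (by omega) hk1
          refine ⟨[(var b 1 (by norm_num), false), (var bp 1 (by norm_num), true), (var b 0 (by norm_num), true)],
            by simp, ?_, ?_⟩
          · intro u hu
            rw [hword]
            apply hker _ _ u hu
            intro b' x
            simp only [List.map_cons, List.map_nil, List.prod_cons, List.prod_nil, mul_one, if_true,
              Bool.false_eq_true, if_false, hBvar]
            by_cases hb' : b' = b
            · simp [blk, hb']
            · by_cases hle : b' ≤ b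
              · have hle' : b' ≤ bp := by
                  show b'.val ≤ k - 1
                  have h1 : b'.val ≤ k := hle
                  have h2 : b'.val ≠ k := fun h => hb' (Fin.ext h)
                  omega
                simp [blk, hle']
              · simp [blk, hle]
          · simp [Clause.eval, Literal.eval, hy, hzp]
            exact hzk
      · -- (ii-b) `y_b` true: the gadget on block `b`
        have hy' : σ (var b 0 (by norm_num)) = true := by simpa using hy
        by_cases hx0 : σ (var b 2 (by norm_num)) = true
        · refine ⟨[(var b 0 (by norm_num), false), (var b 2 (by norm_num), false)], by simp, ?_, ?_⟩
          · intro u hu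
            rw [hword]
            apply hker _ _ u hu
            intro b' x
            simp only [List.map_cons, List.map_nil, List.prod_cons, List.prod_nil, mul_one,
              Bool.false_eq_true, if_false, hBvar]
            by_cases hb' : b' = b
            · subst hb'; fin_cases x <;> simp [blk, G0]
            · simp [blk, hb']
          · simp [Clause.eval, Literal.eval, hy', hx0]
        by_cases hx1 : σ (var b 3 (by norm_num)) = true
        · refine ⟨[(var b 0 (by norm_num), false), (var b 3 (by norm_num), false)], by simp, ?_, ?_⟩
          · intro u hu
            rw [hword]
            apply hker _ _ u hu
            intro b' x
            simp only [List.map_cons, List.map_nil, List.prod_cons, List.prod_nil, mul_one,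
              Bool.false_eq_true, if_false, hBvar]
            by_cases hb' : b' = b
            · subst hb'; fin_cases x <;> simp [blk, G1]
            · simp [blk, hb']
          · simp [Clause.eval, Literal.eval, hy', hx1]
        by_cases hx2 : σ (var b 4 (by norm_num)) = false
        · refine ⟨[(var b 0 (by norm_num), false), (var b 2 (by norm_num), true), (var b 4 (by norm_num), true)],
            by simp, ?_, ?_⟩
          · intro u hu
            rw [hword]
            apply hker _ _ u hu
            intro b' x
            simp only [List.map_cons, List.map_nil, List.prod_cons, List.prod_nil, mul_one, if_true,
              Bool.false_eq_true, if_false, hBvar]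
            by_cases hb' : b' = b
            · subst hb'
              have : (1 - G0) * (1 - G2) = 0 := one_sub_g0_mul_one_sub_g2
              simp [blk, this]
            · simp [blk, hb']
          · have hx0' : σ (var b 2 (by norm_num)) = false := by simpa using hx0
            simp [Clause.eval, Literal.eval, hy', hx0', hx2]
        · refine ⟨[(var b 0 (by norm_num), false), (var b 3 (by norm_num), true), (var b 4 (by norm_num), false)],
            by simp, ?_, ?_⟩
          · intro u hu
            rw [hword]
            apply hker _ _ u hu
            intro b' x
            simp only [List.map_cons, List.map_nil, List.prod_cons, List.prod_nil, mul_one, if_true,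
              Bool.false_eq_true, if_false, hBvar]
            by_cases hb' : b' = b
            · subst hb'
              have : (1 - G1) * G2 = 0 := one_sub_g1_mul_g2
              simp [blk, this]
            · simp [blk, hb']
          · have hx1' : σ (var b 3 (by norm_num)) = false := by simpa using hx1
            have hx2' : σ (var b 4 (by norm_num)) = true := by simpa using hx2
            simp [Clause.eval, Literal.eval, hy', hx1', hx2']

end Summit.PneNP.PneNP.Theorems.CnfIdealGenLengthRankDefectRepresentationsLinearPhantoms
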